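import Literature.Analysis.UnboundedOperators.LinearizedBoltzmannBddAboveProofs
import Literature.Analysis.UnboundedOperators.LinearizedBoltzmannSymmetryProofs
import Literature.Analysis.UnboundedOperators.LinearizedBoltzmannSpectralGapProofs
import HarnessLib

/-!
# Proofs for `LinearizedBoltzmann`: the Dirichlet-form facts reduced to the spectral gap alone

Companion of `Literature/Analysis/UnboundedOperators/LinearizedBoltzmann.lean` (prelude C8).
With the symmetry fact now discharged
(`maxwellianInner_linearizedCollisionOp_comm_holds`, file `LinearizedBoltzmannSymmetryProofs.lean`)
and the reductions of `LinearizedBoltzmannBddAboveProofs.lean` /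
`LinearizedBoltzmannPositivityProofs.lean`, the two remaining named facts about the variational
Dirichlet form `dirichletFormInv hardSphereLinearizedOp A = ⨆ g, (2⟪A, g⟫_M + ⟪g, L g⟫_M)`,

* `bddAbove_range_dirichlet_of_orthogonal` (boundedness of the family, by `‖A‖²_M / λ`), and
* `dirichletFormInv_pos_of_orthogonal_of_ne_zero` (`⟪A, (-L)⁻¹ A⟫_M > 0` for `A ≠ 0`),

depend on exactly ONE undischarged fact: the hard-sphere spectral gap
`le_neg_maxwellianInner_hardSphereLinearizedOp_of_orthogonal` (Baranger–Mouhot, Rev. Mat.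
Iberoam. 21 (2005), Thm 1.1; qualitatively CIP 1994 §7.2, Thm 7.2.5: `0` is an isolated point of
`σ(L)`). This file records the two one-line reductions; once
`le_neg_maxwellianInner_hardSphereLinearizedOp_of_orthogonal_holds` exists, the discharges are
`bddAbove_range_dirichlet_of_orthogonal_of_gap ‹_›_holds` and
`dirichletFormInv_pos_of_orthogonal_of_ne_zero_of_gap ‹_›_holds`.

**Discharges (2026-08-15).** The spectral gap is now proved
(`le_neg_maxwellianInner_hardSphereLinearizedOp_of_orthogonal_holds`, file
`LinearizedBoltzmannSpectralGapProofs.lean`: fibre reduction + one-dimensional coercivity +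
polynomial density, with an explicit `λ`), so both facts are discharged at the end of this file:
`bddAbove_range_dirichlet_of_orthogonal_holds` and
`dirichletFormInv_pos_of_orthogonal_of_ne_zero_holds`. In the printed source the two statements
are the content of CIP 1994 §7.2: Thm 7.2.1, p. 197 (`L` self-adjoint and non-positive in `L²`,
null space = the collision invariants) together with Thm 7.2.5, p. 201 (the spectrum of `L` is
discrete in `(-ν₀, 0]` and essential on `(-∞, -ν₀]`, so `0` is an isolated eigenvalue and `-L` has
a bounded inverse on `(ker L)^⊥`), whence `sup_g (2⟪A, g⟫ + ⟪g, Lg⟫) = ⟪A, (-L)⁻¹A⟫ ≤ ‖A‖²/λ < ∞`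
and `> 0` for `A ≠ 0`, `A ⊥ ker L`.

Sources: Cercignani–Illner–Pulvirenti, *The Mathematical Theory of Dilute Gases* (1994) §7.2,
Thm 7.2.1, p. 197 and Thm 7.2.5, p. 201.
-/

namespace Literature.Analysis.UnboundedOperators

variable {E : Type*} [NormedAddCommGroup E] [InnerProductSpace ℝ E] [FiniteDimensional ℝ E]
  [MeasurableSpace E] [BorelSpace E]

/-- **Y from Z.** The variational family `g ↦ 2⟪A, g⟫_M + ⟪g, L g⟫_M` (`g` of temperate growth) is
bounded above for `A ⊥_M` collision invariants — the named fact
`bddAbove_range_dirichlet_of_orthogonal` — as soon as the linearised hard-sphere operator has a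
spectral gap on the `M`-orthogonal complement of the collision invariants (named fact
`le_neg_maxwellianInner_hardSphereLinearizedOp_of_orthogonal`); the symmetry of `L` used in
`bddAbove_range_dirichlet_of_orthogonal_of_comm_of_gap` is the discharged fact
`maxwellianInner_linearizedCollisionOp_comm_holds` (CIP 1994 §7.2, Thm 7.2.1, p. 197).
[cite: CIP1994, §7.2 Thm 7.2.1 p. 197] -/
theorem bddAbove_range_dirichlet_of_orthogonal_of_gap
    (hZ : le_neg_maxwellianInner_hardSphereLinearizedOp_of_orthogonal (E := E)) :
    bddAbove_range_dirichlet_of_orthogonal (E := E) :=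
  bddAbove_range_dirichlet_of_orthogonal_of_comm_of_gap
    maxwellianInner_linearizedCollisionOp_comm_holds hZ

/-- **The positivity fact from Z.** `⟪A, (-L)⁻¹ A⟫_M > 0` for every non-zero `A` of temperate
growth `M`-orthogonal to the collision invariants — the named fact
`dirichletFormInv_pos_of_orthogonal_of_ne_zero` — as soon as the spectral-gap fact
`le_neg_maxwellianInner_hardSphereLinearizedOp_of_orthogonal` holds
(CIP 1994 §7.2, Thm 7.2.1, p. 197; Baranger–Mouhot 2005, Thm 1.1).
[cite: CIP1994, §7.2 Thm 7.2.1 p. 197] -/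
theorem dirichletFormInv_pos_of_orthogonal_of_ne_zero_of_gap
    (hZ : le_neg_maxwellianInner_hardSphereLinearizedOp_of_orthogonal (E := E)) :
    dirichletFormInv_pos_of_orthogonal_of_ne_zero (E := E) :=
  dirichletFormInv_pos_of_orthogonal_of_ne_zero_of_bddAbove
    (bddAbove_range_dirichlet_of_orthogonal_of_gap hZ)

/-! ### The discharges -/

/-- **Discharge of `bddAbove_range_dirichlet_of_orthogonal`.** In velocity dimension `d ≥ 2`, for
every `A` of temperate growth that is `M`-orthogonal to the collision invariants, the variational
family `g ↦ 2⟪A, g⟫_M + ⟪g, L g⟫_M` (`g` of temperate growth, `L` the linearised hard-sphere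
operator) is bounded above — by `‖A‖²_M / λ`, `λ > 0` the spectral gap of `-L` on the
`M`-orthogonal complement of the collision invariants. Assembled from the reduction
`bddAbove_range_dirichlet_of_orthogonal_of_gap` (symmetry of `L`, CIP 1994 §7.1 (1.9) and §7.2
Thm 7.2.1, p. 197: `L` self-adjoint, non-positive, null space = collision invariants; complete the
square) and the proved gap `le_neg_maxwellianInner_hardSphereLinearizedOp_of_orthogonal_holds`
(CIP 1994 §7.2 Thm 7.2.5, p. 201: `0` is an isolated point of `σ(L)`; quantitatively
Baranger–Mouhot 2005, Thm 1.1).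
[cite: CIPDiluteGases1994, §7.2 Thm 7.2.1 p. 197 and Thm 7.2.5 p. 201] -/
theorem bddAbove_range_dirichlet_of_orthogonal_holds :
    bddAbove_range_dirichlet_of_orthogonal (E := E) :=
  bddAbove_range_dirichlet_of_orthogonal_of_gap
    le_neg_maxwellianInner_hardSphereLinearizedOp_of_orthogonal_holds

/-- **Discharge of `dirichletFormInv_pos_of_orthogonal_of_ne_zero`.** In velocity dimension
`d ≥ 2`, `⟪A, (-L)⁻¹ A⟫_M = dirichletFormInv hardSphereLinearizedOp A > 0` for every non-zero `A`
of temperate growth `M`-orthogonal to the collision invariants (so the Chapman–Enskog viscosity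
and heat conductivity are strictly positive). Assembled from
`dirichletFormInv_pos_of_orthogonal_of_ne_zero_of_gap` (take `g = ε A`, `ε` small, in the
now-bounded variational family) and the proved gap
`le_neg_maxwellianInner_hardSphereLinearizedOp_of_orthogonal_holds`
(CIP 1994 §7.2 Thm 7.2.1, p. 197 and Thm 7.2.5, p. 201; Baranger–Mouhot 2005, Thm 1.1).
[cite: CIPDiluteGases1994, §7.2 Thm 7.2.1 p. 197 and Thm 7.2.5 p. 201] -/
theorem dirichletFormInv_pos_of_orthogonal_of_ne_zero_holds :
    dirichletFormInv_pos_of_orthogonal_of_ne_zero (E := E) :=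
  dirichletFormInv_pos_of_orthogonal_of_ne_zero_of_gap
    le_neg_maxwellianInner_hardSphereLinearizedOp_of_orthogonal_holds

end Literature.Analysis.UnboundedOperators
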